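import Mathlib
import Summits.NavierStokesRegularity.NavierStokesRegularity.Theorems.TaoLadderRungTwoFlatGaugeGronwallOn
import Summits.NavierStokesRegularity.NavierStokesRegularity.Theorems.TaoLadderRungTwoFlatRenormFrameOn
import Summits.NavierStokesRegularity.NavierStokesRegularity.Theorems.TaoLadderRungTwoFlatMirrorTableDefs
import HarnessLib

/-!
# The GRADED a-priori deviation bound during a hop: gauge Grönwall for two exact graded certificate flows through the
  renormalised frame (helper for the K_A♭ parent item stmt-NavierStokesRegularity-22987 `FlatGapCertificatesV2`, child 2A
  `GradedAdiabaticWakeA` of route TaoLadderRungTwoFlat; cell harvest/h2-tao-ladder, p1 g22; the graded counterpart of the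
  flat in-hop a-priori control `MirrorPulse.core_apriori_flat`, first step)

The window gauge Grönwall `QuadPolar.gauge_abs_sub_le_Icc` is stated for FLAT dynamics (`quadTermOn 𝕊 0 α`). An exact graded
certificate flow `PseudoFlowOnShift S♭ τ ε₀ T♭(ε) 0 0 S₀ (½S₀²) 0 S F` is, in the renormalised amplitudes `U = c·S`
(`c_k = (1+ε₀)^{5k/2}`), an exact FLAT flow of the renormalised table `α̃ = renormTable ε₀ T♭(ε)`
(`RenormFrame.pseudoFlowOnShift_renorm`). Reading a gauge `ω` on `S` as the gauge `ω/c` on `U` transports the flat lemma: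

* `MirrorPulse.gauge_deviation_of_gradedFlows` — for two exact graded flows `S`, `W` on `[0, τ]`, a gauge `ω` whose
  renormalised version `ω/c` is window-regular with constant `Λ`, CLOCK-WEIGHTED sup bounds `c_k|S_k|, c_k|W_k| ≤ M̃` on the
  window (the natural a-priori quantity of the graded lattice: ahead the states are doubly-exponentially small, behind the
  clocks vanish), and the initial gauge distance `ω|S₀ − W₀| ≤ B` over ALL shells:
  `ω_{i,k}|S_{i,k}(s) − W_{i,k}(s)| ≤ B·e^{2‖α̃‖₁ M̃ Λ s}` on `[0, τ]`.
  With `ω = geomGauge g b` the initial distance `B` is the core deviation `δ(n)` plus the `b^{-depth}`-discounted near/behind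
  junk plus the kick — the frame's `m₂₁ = O(b^{−K})` coupling read at time `0` instead of through the interface forcing.

HONEST FRAMING: a conditional finite-time estimate about MODEL-lattice certificate flows (Tao 2016 §4 vocabulary on `S♭`);
all bounds are HYPOTHESES; nothing certified; nothing about the Navier–Stokes equations.
-/

noncomputable section

-- the sub-problem namespace repeats the summit name by design (D-0017)
set_option linter.dupNamespace false

namespace Summit.NavierStokesRegularity.NavierStokesRegularity.Theorems

open Set Filter Literature.Analysis.FluidPDE Literature.Analysis.FluidPDE.TaoCascade QuadPolar RenormFrame
open scoped Topology

namespace MirrorPulse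

/-- **GAUGE DEVIATION OF TWO EXACT GRADED FLOWS (renormalised-frame Grönwall).** See the module docstring.
[cite: Tao2016AveragedNS, §4 Lemma 4.1 (4.8), §6.4 (the rescaled system); route TaoLadderRungTwoFlat, graded in-hop a-priori control for `TubeStepCore` (child 2A)] -/
theorem gauge_deviation_of_gradedFlows {ε ε₀ τ : ℝ} {W₀ S₀ : Fin 2 → ℤ → ℝ} {W FW S FS : Fin 2 → ℤ → ℝ → ℝ}
    (hW : PseudoFlowOnShift shiftSetFlat τ ε₀ (mirrorTable ε ε) 0 0 W₀ (fun i k => (1 / 2) * W₀ i k ^ 2)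
      (fun _ _ => 0) W FW)
    (hS : PseudoFlowOnShift shiftSetFlat τ ε₀ (mirrorTable ε ε) 0 0 S₀ (fun i k => (1 / 2) * S₀ i k ^ 2)
      (fun _ _ => 0) S FS)
    (hε₀ : 0 ≤ ε₀) {ω : Fin 2 → ℤ → ℝ} {Λ Mt B : ℝ}
    (hωreg : IsWindowRegular (fun i k => ω i k / clockW ε₀ k) Λ)
    (hSb : ∀ i k, ∀ t ∈ Icc 0 τ, clockW ε₀ k * |S i k t| ≤ Mt)
    (hWb : ∀ i k, ∀ t ∈ Icc 0 τ, clockW ε₀ k * |W i k t| ≤ Mt)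
    (hB : ∀ i k, ω i k * |S₀ i k - W₀ i k| ≤ B) (i : Fin 2) (k : ℤ) {s : ℝ} (hs : s ∈ Icc 0 τ) :
    ω i k * |S i k s - W i k s|
      ≤ B * Real.exp (2 * tableAbsSum shiftSetFlat (renormTable ε₀ (mirrorTable ε ε)) * Mt * Λ * s) := by
  have hε' : (-1 : ℝ) < ε₀ := by linarith
  have hc : ∀ k, 0 < clockW ε₀ k := clockW_pos hε'
  -- the two renormalised flat flows
  have hU := pseudoFlowOnShift_renorm hε₀ hS
  have hV := pseudoFlowOnShift_renorm hε₀ hW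
  have hUc : ∀ j n, ContinuousOn (renormFam ε₀ S j n) (Icc 0 τ) := fun j n => continuousOn_of_pseudoFlowOnShift hU j n
  have hVc : ∀ j n, ContinuousOn (renormFam ε₀ W j n) (Icc 0 τ) := fun j n => continuousOn_of_pseudoFlowOnShift hV j n
  have hUd : ∀ j n, ∀ t ∈ Ioo 0 τ, HasDerivAt (renormFam ε₀ S j n)
      (quadTermOn shiftSetFlat 0 (renormTable ε₀ (mirrorTable ε ε)) (renormFam ε₀ S) j n t) t :=
    fun j n t ht => hasDerivAt_of_pseudoFlowOnShift_exact hU j n ht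
  have hVd : ∀ j n, ∀ t ∈ Ioo 0 τ, HasDerivAt (renormFam ε₀ W j n)
      (quadTermOn shiftSetFlat 0 (renormTable ε₀ (mirrorTable ε ε)) (renormFam ε₀ W) j n t) t :=
    fun j n t ht => hasDerivAt_of_pseudoFlowOnShift_exact hV j n ht
  -- clock-weighted sup bounds = plain sup bounds of the renormalised amplitudes
  have hUb : ∀ j n, ∀ t ∈ Icc 0 τ, |renormFam ε₀ S j n t| ≤ Mt := by
    intro j n t ht
    simp only [renormFam, abs_mul, abs_of_pos (hc n)]
    exact hSb j n t ht
  have hVb : ∀ j n, ∀ t ∈ Icc 0 τ, |renormFam ε₀ W j n t| ≤ Mt := by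
    intro j n t ht
    simp only [renormFam, abs_mul, abs_of_pos (hc n)]
    exact hWb j n t ht
  -- the initial gauge distance in the renormalised gauge
  have hB' : ∀ j n, (fun i k => ω i k / clockW ε₀ k) j n * |renormFam ε₀ S j n 0 - renormFam ε₀ W j n 0| ≤ B := by
    intro j n
    have hcn := hc n
    simp only [renormFam, hS.init_S j n, hW.init_S j n]
    rw [← mul_sub, abs_mul, abs_of_pos hcn]
    have e : ω j n / clockW ε₀ n * (clockW ε₀ n * |S₀ j n - W₀ j n|) = ω j n * |S₀ j n - W₀ j n| := by
      field_simp
    rw [e]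
    exact hB j n
  have hmain := gauge_abs_sub_le_Icc isNearestNeighbourSet_shiftSetFlat (renormTable ε₀ (mirrorTable ε ε)) hωreg
    hUc hVc hUd hVd hUb hVb hB' i k hs
  -- back to the original amplitudes
  have hck := hc k
  simp only [renormFam] at hmain
  rw [← mul_sub, abs_mul, abs_of_pos hck] at hmain
  have e : ω i k / clockW ε₀ k * (clockW ε₀ k * |S i k s - W i k s|) = ω i k * |S i k s - W i k s| := by
    field_simp
  rw [e] at hmain
  exact hmain

end MirrorPulse

end Summit.NavierStokesRegularity.NavierStokesRegularity.Theorems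

end
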